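import Summits.Ventures.GridStability.Models.WSCC9FaultOnTrigEnclosure

/-!
# WSCC9FaultOnTubeLegs — legs, boxes, the rational checks and ONE LEG of the N-leg kernel tube integrator for the WSCC9 bus-7 fault-on motion (part 2)

Venture GRIDFUSION (LADDER-GRIDFUSION G1-cct, «#61⁗»-successor input; seat gridfusion-model-1 g6).  Purpose: remove the «tube FATNESS»
ceiling of the clearing-time lane (lead g5 RULING 6f / memo fold #35: the 3-leg kernel chain p510936 → p524020 encloses the fault-on state
at `t = 0.115 s` only to `Δa₃ ≈ 0.033 rad`, `Δω₃ ≈ 0.56 rad/s`) — the fatness is an artefact of the LEG COUNT, not of Moore's method: lit-1's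
one-leg lemma `Literature.Analysis.ODE.secondOrder_tube_restart` (p501879; Moore 1979 §8.1, step-by-step continuation after (8.5)) becomes
a CHAIN CHECKER whose every hypothesis is a rational inequality, so that any list of legs is certified by ONE `decide`.
OBJECTS.  `KBox6` = state box at a restart time (translated angles `q_i = δ_i − δ₁(0)`, printed speeds `ω_i`); `Leg` = `(τ, A, B, C, D, L, H)`:
duration, the coordinate box `[A, B] × [C, D]` that must contain the leg's motion, the claimed acceleration bounds `[L, H]` on it.  CHECKS
(Bool): `Leg.fieldOK` — `a = q₃ − q₁ ∈ [amin, amax] ⊆ [0, 7/5]` on the box and the three accelerations of `WSCC9.faultBus7Printed`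
(`ω̇₁ = (P′₁ − G₁₁ + g(a) − D₁ω₁)/M₁`, `ω̇₂ = (P′₂ − D₂ω₂)/M₂`, `ω̇₃ = (P′₃ − G₃₃ − f(a) − D₃ω₃)/M₃`; `faultBus7_Pe_zero/one/two`) lie in `[L, H]`
(monotone couplings at the rational endpoints, Taylor-enclosed `sin`/`cos`, damping at the worst speed corners); `Leg.inclOK K` — Moore's four
strict inclusions at the full step `τ`; `Leg.next K` — the box at the end of the leg; `chainOK`, `kboxAt`, `startAt`, `legAt`; `K0` = the
printed pre-fault box.  SOUNDNESS here: `fieldBounds_of_fieldOK`, `leg_step` (one leg on `[a, T]`, `T − a ≤ τ`, the inclusions at the horizon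
following from those at `τ` by isotonicity).  The chain and the slice boxes: `WSCC9FaultOnTubeChain`.  THREE COLUMNS: CERTIFIED = tube
sentences for MODEL M′ (classical WSCC9, MV-2 + MV-P + MV-SPD + MV-h12, bolted fault at bus 7); VALIDATED = model-4's tubes / RK4 arc; no
stability claim.  [cite: Moore1979, §8.1 eqs. (8.5), (8.10) and the step-by-step continuation after (8.5); AndersonFouad1977, Example 2.6]
-/

noncomputable section

open Real Set Finset

namespace Summit.Ventures.GridStability.Models

namespace WSCC9

namespace FaultOnLeg

/-! ### §1 Boxes, legs and the rational checks -/

/-- A STATE BOX at a restart time: translated angles `q_i = δ_i − δ₁(0) ∈ [qlo_i, qhi_i]`, printed speeds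
`ω_i ∈ [wlo_i, whi_i]` (machines `i = 0, 1, 2`). -/
structure KBox6 where
  /-- lower angle corners -/
  qlo : Fin 3 → ℚ
  /-- upper angle corners -/
  qhi : Fin 3 → ℚ
  /-- lower speed corners -/
  wlo : Fin 3 → ℚ
  /-- upper speed corners -/
  whi : Fin 3 → ℚ

/-- Two K-boxes with the same corners are equal (used to spell computed boxes out as literals). -/
theorem KBox6.eq_of_forall {K K' : KBox6}
    (h : ∀ i, K.qlo i = K'.qlo i ∧ K.qhi i = K'.qhi i ∧ K.wlo i = K'.wlo i ∧ K.whi i = K'.whi i) : K = K' := by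
  obtain ⟨a, b, c, d⟩ := K
  obtain ⟨a', b', c', d'⟩ := K'
  simp only [KBox6.mk.injEq]
  exact ⟨funext fun i => (h i).1, funext fun i => (h i).2.1, funext fun i => (h i).2.2.1, funext fun i => (h i).2.2.2⟩

/-- ONE LEG of the chain: duration `τ`, coordinate box `[A, B]` (angles) `× [C, D]` (speeds) containing the leg's motion,
and the claimed acceleration bounds `[L, H]` (rad/s²) on that box. -/
structure Leg where
  /-- leg duration (s) -/
  τ : ℚ
  /-- angle box, lower corners -/
  A : Fin 3 → ℚ
  /-- angle box, upper corners -/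
  B : Fin 3 → ℚ
  /-- speed box, lower corners -/
  C : Fin 3 → ℚ
  /-- speed box, upper corners -/
  D : Fin 3 → ℚ
  /-- claimed lower acceleration bounds on the box -/
  L : Fin 3 → ℚ
  /-- claimed upper acceleration bounds on the box -/
  H : Fin 3 → ℚ

namespace Leg

/-- Smallest angle difference `a = q₃ − q₁` on the box. -/
def amin (d : Leg) : ℚ := d.A 2 - d.B 0

/-- Largest angle difference `a = q₃ − q₁` on the box. -/
def amax (d : Leg) : ℚ := d.B 2 - d.A 0

/-- FIELD CHECK: `[amin, amax] ⊆ [0, 7/5]` and the three accelerations of `faultBus7Printed` lie in `[L, H]` on the box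
(joint monotone coupling bounds at the rational endpoints, Taylor-enclosed `sin`/`cos`, speeds at the damping-worst corners). -/
def fieldOK (d : Leg) : Bool :=
  decide (0 ≤ d.amin) && decide (d.amin ≤ d.amax) && decide (d.amax ≤ 7 / 5) &&
  decide (d.L 0 * M 0 ≤ Pprinted 0 - G11 + (Cc * sinLo d.amin - Dd * cosHi d.amin) - D_SP 0 * d.D 0) &&
  decide (Pprinted 0 - G11 + (Cc * sinHi d.amax - Dd * cosLo d.amax) - D_SP 0 * d.C 0 ≤ d.H 0 * M 0) &&
  decide (d.L 1 * M 1 ≤ Pprinted 1 - D_SP 1 * d.D 1) &&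
  decide (Pprinted 1 - D_SP 1 * d.C 1 ≤ d.H 1 * M 1) &&
  decide (d.L 2 * M 2 ≤ Pprinted 2 - G33 - (Cc * sinHi d.amax + Dd * cosHi d.amax) - D_SP 2 * d.D 2) &&
  decide (Pprinted 2 - G33 - (Cc * sinLo d.amin + Dd * cosLo d.amin) - D_SP 2 * d.C 2 ≤ d.H 2 * M 2)

/-- INCLUSION CHECK (Moore's four strict inclusions at the full step `τ`, from the restart box `K`). -/
def inclOK (d : Leg) (K : KBox6) : Bool :=
  decide (0 < d.τ) &&
  decide (∀ i : Fin 3, d.A i < K.qlo i + min 0 (K.wlo i * d.τ) + min (d.L i) 0 * d.τ ^ 2 / 2 ∧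
    K.qhi i + max 0 (K.whi i * d.τ) + max (d.H i) 0 * d.τ ^ 2 / 2 < d.B i ∧
    d.C i < K.wlo i + min (d.L i) 0 * d.τ ∧ K.whi i + max (d.H i) 0 * d.τ < d.D i)

/-- The state box at the END of the leg: `ω_i ∈ [wlo_i + L_i τ, whi_i + H_i τ]`,
`q_i ∈ [qlo_i + wlo_i τ + L_i τ²/2, qhi_i + whi_i τ + H_i τ²/2]`. -/
def next (d : Leg) (K : KBox6) : KBox6 where
  qlo i := K.qlo i + K.wlo i * d.τ + d.L i * d.τ ^ 2 / 2
  qhi i := K.qhi i + K.whi i * d.τ + d.H i * d.τ ^ 2 / 2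
  wlo i := K.wlo i + d.L i * d.τ
  whi i := K.whi i + d.H i * d.τ

/-- The TUBE SET of leg `d` re-based at the state `xa` (the state at the restart time `a`), elapsed time `s = t − a`:
the states `x` with, machine-wise, `L_i s ≤ x.ω_i − xa.ω_i ≤ H_i s` and `L_i s²/2 ≤ x.δ_i − xa.δ_i − xa.ω_i s ≤ H_i s²/2`
(Moore's enclosure shape). -/
def tubeSet (d : Leg) (xa : ClassicalSwing.State 3) (s : ℝ) : Set (ClassicalSwing.State 3) :=
  {x | ∀ i, (d.L i : ℝ) * s ≤ x.2 i - xa.2 i ∧ x.2 i - xa.2 i ≤ (d.H i : ℝ) * s ∧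
    (d.L i : ℝ) * s ^ 2 / 2 ≤ x.1 i - xa.1 i - xa.2 i * s ∧ x.1 i - xa.1 i - xa.2 i * s ≤ (d.H i : ℝ) * s ^ 2 / 2}

/-- Unfolding `tubeSet` membership. -/
theorem mem_tubeSet (d : Leg) (xa x : ClassicalSwing.State 3) (s : ℝ) :
    x ∈ d.tubeSet xa s ↔ ∀ i, (d.L i : ℝ) * s ≤ x.2 i - xa.2 i ∧ x.2 i - xa.2 i ≤ (d.H i : ℝ) * s ∧
      (d.L i : ℝ) * s ^ 2 / 2 ≤ x.1 i - xa.1 i - xa.2 i * s ∧ x.1 i - xa.1 i - xa.2 i * s ≤ (d.H i : ℝ) * s ^ 2 / 2 :=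
  Iff.rfl

end Leg

/-- The STATE SET of the box `K` for the reference angle `r = δ₁(0)`: states `x` with `x.δ_i − r ∈ [qlo_i, qhi_i]` and
`x.ω_i ∈ [wlo_i, whi_i]`.  «`K` holds at time `a`» = `Y a ∈ K.toSet ((Y 0).1 0)`. -/
def KBox6.toSet (K : KBox6) (r : ℝ) : Set (ClassicalSwing.State 3) :=
  {x | ∀ i, (K.qlo i : ℝ) ≤ x.1 i - r ∧ x.1 i - r ≤ (K.qhi i : ℝ) ∧ (K.wlo i : ℝ) ≤ x.2 i ∧ x.2 i ≤ (K.whi i : ℝ)}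

/-- Unfolding `KBox6.toSet` membership. -/
theorem KBox6.mem_toSet (K : KBox6) (r : ℝ) (x : ClassicalSwing.State 3) :
    x ∈ K.toSet r ↔ ∀ i, (K.qlo i : ℝ) ≤ x.1 i - r ∧ x.1 i - r ≤ (K.qhi i : ℝ) ∧ (K.wlo i : ℝ) ≤ x.2 i ∧ x.2 i ≤ (K.whi i : ℝ) :=
  Iff.rfl

/-- CHAIN CHECK along a list of legs from the box `K`. -/
def chainOK : KBox6 → List Leg → Bool
  | _, [] => true
  | K, d :: ds => d.fieldOK && d.inclOK K && chainOK (d.next K) ds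

/-- The state box at the start of leg `k` (after the first `k` legs). -/
def kboxAt : KBox6 → List Leg → ℕ → KBox6
  | K, _, 0 => K
  | K, [], _ + 1 => K
  | K, d :: ds, k + 1 => kboxAt (d.next K) ds k

/-- The start time of leg `k`. -/
def startAt : ℚ → List Leg → ℕ → ℚ
  | a, _, 0 => a
  | a, [], _ + 1 => a
  | a, d :: ds, k + 1 => startAt (a + d.τ) ds k

/-- Leg `k` of the list (a dummy zero leg past the end). -/
def legAt (legs : List Leg) (k : ℕ) : Leg := legs.getD k ⟨0, 0, 0, 0, 0, 0, 0⟩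

/-- The PRE-FAULT BOX `K₀` at `t = 0`: reference angle `0`, `a₂ ∈ a2Window`, `a₃ ∈ a3Window`, all speeds `0`. -/
def K0 : KBox6 where
  qlo := ![0, 7617 / 25000, 761 / 4000]
  qhi := ![0, 15239 / 50000, 3807 / 20000]
  wlo := ![0, 0, 0]
  whi := ![0, 0, 0]

/-- `K₀` holds at `t = 0` for every motion from the printed pre-fault point at synchronous speed. -/
theorem K0_holds {Y : ℝ → ClassicalSwing.State 3} (hω0 : (Y 0).2 = 0)
    (ha2 : (Y 0).1 1 - (Y 0).1 0 ∈ a2Window) (ha3 : (Y 0).1 2 - (Y 0).1 0 ∈ a3Window) :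
    Y 0 ∈ K0.toSet ((Y 0).1 0) := by
  obtain ⟨ha2l, ha2u⟩ := ha2
  obtain ⟨ha3l, ha3u⟩ := ha3
  norm_num at ha2l ha2u ha3l ha3u
  have hw : ∀ i, (Y 0).2 i = 0 := fun i => by rw [hω0]; rfl
  rw [KBox6.mem_toSet]
  intro i
  fin_cases i
  · show ((K0.qlo 0 : ℚ) : ℝ) ≤ (Y 0).1 0 - (Y 0).1 0 ∧ (Y 0).1 0 - (Y 0).1 0 ≤ ((K0.qhi 0 : ℚ) : ℝ) ∧
      ((K0.wlo 0 : ℚ) : ℝ) ≤ (Y 0).2 0 ∧ (Y 0).2 0 ≤ ((K0.whi 0 : ℚ) : ℝ)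
    rw [hw 0, sub_self]
    norm_num [K0]
  · show ((K0.qlo 1 : ℚ) : ℝ) ≤ (Y 0).1 1 - (Y 0).1 0 ∧ (Y 0).1 1 - (Y 0).1 0 ≤ ((K0.qhi 1 : ℚ) : ℝ) ∧
      ((K0.wlo 1 : ℚ) : ℝ) ≤ (Y 0).2 1 ∧ (Y 0).2 1 ≤ ((K0.whi 1 : ℚ) : ℝ)
    rw [hw 1]
    norm_num [K0]
    exact ⟨ha2l, ha2u⟩
  · show ((K0.qlo 2 : ℚ) : ℝ) ≤ (Y 0).1 2 - (Y 0).1 0 ∧ (Y 0).1 2 - (Y 0).1 0 ≤ ((K0.qhi 2 : ℚ) : ℝ) ∧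
      ((K0.wlo 2 : ℚ) : ℝ) ≤ (Y 0).2 2 ∧ (Y 0).2 2 ≤ ((K0.whi 2 : ℚ) : ℝ)
    rw [hw 2]
    norm_num [K0, Matrix.cons_val_two, Matrix.tail_cons, Matrix.head_cons]
    exact ⟨ha3l, ha3u⟩
/-! ### §2 Soundness of the field check -/

/-- `M_i > 0` and `D_i ≥ 0` of the WSCC9 machines (cast to `ℝ`). -/
theorem M_pos_D_nonneg : (∀ i : Fin 3, (0 : ℝ) < (M i : ℝ)) ∧ ∀ i : Fin 3, (0 : ℝ) ≤ (D_SP i : ℝ) := by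
  constructor
  · intro i; fin_cases i <;> norm_num [M]
  · intro i; fin_cases i <;> norm_num [D_SP]

/-- **Kernel field bounds from the rational check.** `d.fieldOK` ⇒ on the box `[A, B] × [C, D]` the accelerations of
`faultBus7Printed` lie in `[L, H]`. -/
theorem fieldBounds_of_fieldOK {d : Leg} (h : d.fieldOK = true) (x : ClassicalSwing.State 3)
    (hx : ∀ i, (d.A i : ℝ) ≤ x.1 i ∧ x.1 i ≤ (d.B i : ℝ) ∧ (d.C i : ℝ) ≤ x.2 i ∧ x.2 i ≤ (d.D i : ℝ)) :
    ∀ i, (d.L i : ℝ) ≤ (faultBus7Printed.field x).2 i ∧ (faultBus7Printed.field x).2 i ≤ (d.H i : ℝ) := by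
  simp only [Leg.fieldOK, Bool.and_eq_true, decide_eq_true_eq] at h
  obtain ⟨⟨⟨⟨⟨⟨⟨⟨h0, h1⟩, h2⟩, hL0⟩, hH0⟩, hL1⟩, hH1⟩, hL2⟩, hH2⟩ := h
  have hx0 := hx 0
  have hx1 := hx 1
  have hx2 := hx 2
  obtain ⟨hMpos, hDnn⟩ := M_pos_D_nonneg
  -- the angle difference
  set a : ℝ := x.1 2 - x.1 0 with ha
  have hamin : ((d.amin : ℚ) : ℝ) ≤ a := by
    simp only [Leg.amin]; push_cast; linarith [hx0.2.1, hx2.1]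
  have hamax : a ≤ ((d.amax : ℚ) : ℝ) := by
    simp only [Leg.amax]; push_cast; linarith [hx0.1, hx2.2.1]
  have h0' : (0 : ℝ) ≤ ((d.amin : ℚ) : ℝ) := by exact_mod_cast h0
  have h2' : ((d.amax : ℚ) : ℝ) ≤ 7 / 5 := by
    have h2c := (Rat.cast_le (K := ℝ)).2 h2
    push_cast at h2c
    exact h2c
  have hamax0 : (0 : ℝ) ≤ ((d.amax : ℚ) : ℝ) := by linarith
  have hCc : (0 : ℝ) ≤ (Cc : ℝ) := by norm_num [Cc]
  have hDd : (0 : ℝ) ≤ (Dd : ℝ) := by norm_num [Dd]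
  -- Taylor enclosures at the endpoints
  have s1 := mul_le_mul_of_nonneg_left (sinLo_le h0) hCc
  have s2 := mul_le_mul_of_nonneg_left (le_sinHi (le_trans h0 (h1))) hCc
  have c1 := mul_le_mul_of_nonneg_left (cosLo_le d.amin) hDd
  have c2 := mul_le_mul_of_nonneg_left (le_cosHi d.amin) hDd
  have c3 := mul_le_mul_of_nonneg_left (cosLo_le d.amax) hDd
  have c4 := mul_le_mul_of_nonneg_left (le_cosHi d.amax) hDd
  -- joint monotone bounds of f and g at a
  have fm1 := f_mono h0' hamin (hamax.trans h2')
  have fm2 := f_mono (le_trans h0' hamin) hamax h2'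
  have gm1 := g_mono h0' hamin (hamax.trans h2')
  have gm2 := g_mono (le_trans h0' hamin) hamax h2'
  -- cast the rational checks
  have cL0 := (Rat.cast_le (K := ℝ)).2 hL0
  have cH0 := (Rat.cast_le (K := ℝ)).2 hH0
  have cL1 := (Rat.cast_le (K := ℝ)).2 hL1
  have cH1 := (Rat.cast_le (K := ℝ)).2 hH1
  have cL2 := (Rat.cast_le (K := ℝ)).2 hL2
  have cH2 := (Rat.cast_le (K := ℝ)).2 hH2
  push_cast at cL0 cH0 cL1 cH1 cL2 cH2
  -- damping terms at the worst corners
  have w0a := mul_le_mul_of_nonneg_left hx0.2.2.1 (hDnn 0)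
  have w0b := mul_le_mul_of_nonneg_left hx0.2.2.2 (hDnn 0)
  have w1a := mul_le_mul_of_nonneg_left hx1.2.2.1 (hDnn 1)
  have w1b := mul_le_mul_of_nonneg_left hx1.2.2.2 (hDnn 1)
  have w2a := mul_le_mul_of_nonneg_left hx2.2.2.1 (hDnn 2)
  have w2b := mul_le_mul_of_nonneg_left hx2.2.2.2 (hDnn 2)
  have eG11 : ((G11 : ℚ) : ℝ) = 733233515479 / 1000000000000 := by norm_num [G11]
  have eG33 : ((G33 : ℚ) : ℝ) = 179988582327 / 1000000000000 := by norm_num [G33]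
  have eCc : ((Cc : ℚ) : ℝ) = 169392542821 / 250000000000 := by norm_num [Cc]
  have eDd : ((Dd : ℚ) : ℝ) = 75376559101 / 1000000000000 := by norm_num [Dd]
  have hs : Real.sin (x.1 0 - x.1 2) = -Real.sin a := by rw [ha, ← Real.sin_neg]; ring_nf
  have hc : Real.cos (x.1 0 - x.1 2) = Real.cos a := by rw [ha, ← Real.cos_neg]; ring_nf
  intro i
  fin_cases i
  · show (d.L 0 : ℝ) ≤ (faultBus7Printed.field x).2 0 ∧ (faultBus7Printed.field x).2 0 ≤ (d.H 0 : ℝ)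
    rw [faultBus7Printed_field_snd, faultBus7_Pe_zero, hs, hc, ← eG11, ← eCc, ← eDd]
    constructor
    · rw [le_div_iff₀ (hMpos 0)]; linarith
    · rw [div_le_iff₀ (hMpos 0)]; linarith
  · show (d.L 1 : ℝ) ≤ (faultBus7Printed.field x).2 1 ∧ (faultBus7Printed.field x).2 1 ≤ (d.H 1 : ℝ)
    rw [faultBus7Printed_field_snd, faultBus7_Pe_one]
    constructor
    · rw [le_div_iff₀ (hMpos 1)]; linarith
    · rw [div_le_iff₀ (hMpos 1)]; linarith
  · show (d.L 2 : ℝ) ≤ (faultBus7Printed.field x).2 2 ∧ (faultBus7Printed.field x).2 2 ≤ (d.H 2 : ℝ)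
    rw [faultBus7Printed_field_snd, faultBus7_Pe_two, ← ha, ← eG33, ← eCc, ← eDd]
    constructor
    · rw [le_div_iff₀ (hMpos 2)]; linarith
    · rw [div_le_iff₀ (hMpos 2)]; linarith
/-! ### §3 One leg = Moore's restart lemma -/
/-- **ONE LEG.** `d.fieldOK`, `d.inclOK K`, `K` holds at `a ≥ 0`, and a solution on `[0, T]` with `a ≤ T ≤ a + τ` ⇒ the tube of
`d` on `[a, T]` (lit-1's `secondOrder_tube_restart`; the inclusions at the horizon `T − a` follow from those at `τ`). -/
theorem leg_step {d : Leg} {K : KBox6} (hf : d.fieldOK = true) (hi : d.inclOK K = true) {a T : ℝ}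
    (ha : 0 ≤ a) (haT : a ≤ T) (hTτ : T - a ≤ (d.τ : ℝ)) {Y : ℝ → ClassicalSwing.State 3}
    (hY : faultBus7Printed.IsSolutionOn Y (Icc 0 T)) (hK : Y a ∈ K.toSet ((Y 0).1 0)) :
    ∀ t ∈ Icc a T, Y t ∈ d.tubeSet (Y a) (t - a) := by
  simp only [Leg.inclOK, Bool.and_eq_true, decide_eq_true_eq] at hi
  obtain ⟨hτ, hincl⟩ := hi
  rw [KBox6.mem_toSet] at hK
  -- component curves, reference angle translated to 0
  set r : ℝ := (Y 0).1 0 with hr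
  set q : ℝ → Fin 3 → ℝ := fun s j => (Y s).1 j - r with hq
  set v : ℝ → Fin 3 → ℝ := fun s j => (Y s).2 j with hv
  set G : ℝ → Fin 3 → ℝ := fun s j => (faultBus7Printed.field (Y s)).2 j with hG
  have hqd : ∀ i, ∀ t ∈ Icc 0 T, HasDerivWithinAt (fun s => q s i) (v t i) (Icc 0 T) t := by
    intro i t ht
    have h1 : HasDerivWithinAt (fun s => (Y s).1) ((faultBus7Printed.field (Y t)).1) (Icc 0 T) t :=
      (ContinuousLinearMap.fst ℝ (Fin 3 → ℝ) (Fin 3 → ℝ)).hasFDerivAt.comp_hasDerivWithinAt t (hY t ht)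
    have h2 := (hasDerivWithinAt_pi.1 h1 i).sub_const r
    simpa [hq, hv, ClassicalSwing.field] using h2
  have hvd : ∀ i, ∀ t ∈ Icc 0 T, HasDerivWithinAt (fun s => v s i) (G t i) (Icc 0 T) t := by
    intro i t ht
    have h1 : HasDerivWithinAt (fun s => (Y s).2) ((faultBus7Printed.field (Y t)).2) (Icc 0 T) t :=
      (ContinuousLinearMap.snd ℝ (Fin 3 → ℝ) (Fin 3 → ℝ)).hasFDerivAt.comp_hasDerivWithinAt t (hY t ht)
    exact hasDerivWithinAt_pi.1 h1 i
  -- field bounds along the motion while in the box (translation invariance of P_e)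
  have hGB : ∀ t ∈ Icc a T, (∀ i, (d.A i : ℝ) ≤ q t i ∧ q t i ≤ (d.B i : ℝ) ∧ (d.C i : ℝ) ≤ v t i ∧
      v t i ≤ (d.D i : ℝ)) → ∀ i, (d.L i : ℝ) ≤ G t i ∧ G t i ≤ (d.H i : ℝ) := by
    intro t _ hB i
    have hPe : ∀ j, faultBus7Printed.Pe (fun k => (Y t).1 k - r) j = faultBus7Printed.Pe (Y t).1 j := by
      intro j
      have := Pe_add_const faultBus7Printed (Y t).1 (-r) j
      simpa [sub_eq_add_neg] using this
    have hfield : (faultBus7Printed.field ((fun k => (Y t).1 k - r), (Y t).2)).2 i =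
        (faultBus7Printed.field (Y t)).2 i := by
      simp only [ClassicalSwing.field, hPe]
    have key := fieldBounds_of_fieldOK hf ((fun k => (Y t).1 k - r), (Y t).2) hB i
    rw [hfield] at key
    simpa [hG] using key
  -- the four strict inclusions at the horizon s = T − a ≤ τ
  have hs0 : 0 ≤ T - a := by linarith
  have hs2 : (T - a) ^ 2 ≤ (d.τ : ℝ) ^ 2 := pow_le_pow_left₀ hs0 hTτ 2
  have hKa : ∀ i, (d.A i : ℝ) < q a i + min 0 (v a i * (T - a)) + min (d.L i : ℝ) 0 * (T - a) ^ 2 / 2 := by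
    intro i
    obtain ⟨k1, -, k3, -⟩ := hK i
    obtain ⟨c1, -, -, -⟩ := hincl i
    have c1' := (Rat.cast_lt (K := ℝ)).2 c1
    push_cast at c1'
    have m1 := min_zero_mul_mono (τ := (d.τ : ℝ)) k3 hs0 hTτ
    have m3 : min (d.L i : ℝ) 0 * (d.τ : ℝ) ^ 2 / 2 ≤ min (d.L i : ℝ) 0 * (T - a) ^ 2 / 2 := by
      have := mul_le_mul_of_nonpos_left hs2 (min_le_right (d.L i : ℝ) 0)
      linarith
    have e1 : q a i = (Y a).1 i - (Y 0).1 0 := rfl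
    rw [e1]
    linarith
  have hKb : ∀ i, q a i + max 0 (v a i * (T - a)) + max (d.H i : ℝ) 0 * (T - a) ^ 2 / 2 < (d.B i : ℝ) := by
    intro i
    obtain ⟨-, k2, -, k4⟩ := hK i
    obtain ⟨-, c2, -, -⟩ := hincl i
    have c2' := (Rat.cast_lt (K := ℝ)).2 c2
    push_cast at c2'
    have m2 := max_zero_mul_mono (τ := (d.τ : ℝ)) k4 hs0 hTτ
    have m4 : max (d.H i : ℝ) 0 * (T - a) ^ 2 / 2 ≤ max (d.H i : ℝ) 0 * (d.τ : ℝ) ^ 2 / 2 := by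
      have := mul_le_mul_of_nonneg_left hs2 (le_max_right (d.H i : ℝ) 0)
      linarith
    have e1 : q a i = (Y a).1 i - (Y 0).1 0 := rfl
    rw [e1]
    linarith
  have hKc : ∀ i, (d.C i : ℝ) < v a i + min (d.L i : ℝ) 0 * (T - a) := by
    intro i
    obtain ⟨-, -, k3, -⟩ := hK i
    obtain ⟨-, -, c3, -⟩ := hincl i
    have c3' := (Rat.cast_lt (K := ℝ)).2 c3
    push_cast at c3'
    have m5 : min (d.L i : ℝ) 0 * (d.τ : ℝ) ≤ min (d.L i : ℝ) 0 * (T - a) :=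
      mul_le_mul_of_nonpos_left hTτ (min_le_right (d.L i : ℝ) 0)
    have e1 : v a i = (Y a).2 i := rfl
    rw [e1]
    linarith
  have hKd : ∀ i, v a i + max (d.H i : ℝ) 0 * (T - a) < (d.D i : ℝ) := by
    intro i
    obtain ⟨-, -, -, k4⟩ := hK i
    obtain ⟨-, -, -, c4⟩ := hincl i
    have c4' := (Rat.cast_lt (K := ℝ)).2 c4
    push_cast at c4'
    have m6 : max (d.H i : ℝ) 0 * (T - a) ≤ max (d.H i : ℝ) 0 * (d.τ : ℝ) :=
      mul_le_mul_of_nonneg_left hTτ (le_max_right (d.H i : ℝ) 0)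
    have e1 : v a i = (Y a).2 i := rfl
    rw [e1]
    linarith
  have key := Literature.Analysis.ODE.secondOrder_tube_restart (a := a) ha haT
    (lo₂ := fun i => (d.L i : ℝ)) (hi₂ := fun i => (d.H i : ℝ))
    (a₂ := fun i => (d.A i : ℝ)) (b₂ := fun i => (d.B i : ℝ)) (c₂ := fun i => (d.C i : ℝ))
    (d₂ := fun i => (d.D i : ℝ)) hqd hvd hGB hKa hKb hKc hKd
  intro t ht
  rw [Leg.mem_tubeSet]
  intro i
  obtain ⟨k1, k2, k3, k4⟩ := key t ht i
  have e1 : v t i - v a i = (Y t).2 i - (Y a).2 i := rfl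
  have e2 : q t i - q a i - v a i * (t - a) = (Y t).1 i - (Y a).1 i - (Y a).2 i * (t - a) := by
    simp only [hq, hv]; ring
  rw [e1] at k1 k2
  rw [e2] at k3 k4
  exact ⟨k1, k2, k3, k4⟩
end FaultOnLeg

end WSCC9

end Summit.Ventures.GridStability.Models

end
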